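import Summits.CriticalPhenomena.PercolationContinuityZ3.Theorems.PercNonProliferationFreeBoxSparseStubCollarResidues
import Summits.CriticalPhenomena.PercolationContinuityZ3.Theorems.PercNonProliferationFreeBoxSparseStubCollarBridge
import Summits.CriticalPhenomena.PercolationContinuityZ3.Theorems.PercNonProliferationFreeBoxSparseStubCollarSprinkle
import HarnessLib

/-!
# Crux `PercNonProliferation.FreeBoxSparse` (stmt-CriticalPhenomena-4445), line `ccfs-window-kissing-walls` —
# helper for stub `stub_collar`, part 5: collar rarity for one residue class

Helper file for the lead's skeleton of line `ccfs-window-kissing-walls`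
(prover-line-stmt-CriticalPhenomena-4445-0); lands with `--supports stmt-CriticalPhenomena-4445`.

`stub_collar_class` (registered): for `p ∈ (0,1]`, `δ, σ > 0`, `r ∈ ℕ` and every non-empty finite
`Λ ⊂ ℤ³` and residue class `ρ`, the collar event of class `ρ` — some `x, y ∈ Λ` carry `δ`-dense free
pieces NOT joined inside `Λ` while `|Λ|^{1/2+σ} ≤ (2r+1)³ · #{doubly-met interior `r`-balls with
centre `≡ ρ mod 2r+1}` — has `P_p`-probability `≤ C₁ |Λ|^{−σ/2}` with
`C₁ = 1/(2δ²) + √(2(2r+1)⁶ p^{−u}) + (2r+1)³ + (2r+1)⁶ p^{−u}`, `u = ((2r+1)³+1 choose 2)`.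
Proof = parts 1–4: the free volume functional `π_Λ ∈ [0,1]` is increasing (part 3), and on the event
every one of the `m₀ = |Λ|^{1/2+σ}/(2r+1)³` doubly-met balls of class `ρ` is a closed good block
whose opening raises `π_Λ` by `2δ²` (`stub_collar_goodblocks`, part 3'); the sprinkling window (part 2,
`b = (2r+1)³|Λ|^{−1/2−σ/2}`) yields a density `s ≤ b` at which the sprinkled probability of the event
is `≤ |Λ|^{−σ/2}/(2δ²)`, and the `χ²`/TV window (parts 1, 4) returns to `P_p` at cost
`√((1 + s²p^{−u})^{|Λ|} − 1) ≤ √(2(2r+1)⁶p^{−u}) |Λ|^{−σ/2}`; the degenerate regimes `b > 1`,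
`(2r+1)⁶ p^{−u}|Λ|^{−σ} > 1` are absorbed by the last two summands of `C₁`.
-/

noncomputable section

namespace Summit.CriticalPhenomena.PercolationContinuityZ3.Theorems.FreeBoxSparse

open MeasureTheory
open Literature.Probability.Percolation Literature.Probability.LatticeModels
open scoped Classical

namespace StubCollar

open Finset

/-! ### Real-variable bookkeeping -/

/-- `N^{1/2+σ}/M · (M N^{−1/2−σ/2}) = N^{σ/2}`. [folklore] -/
theorem rpow_window_mul (N σ M : ℝ) (hN : 1 ≤ N) (hM : 0 < M) :
    N ^ ((1 : ℝ) / 2 + σ) / M * (M * N ^ (-((1 : ℝ) / 2 + σ / 2))) = N ^ (σ / 2) := by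
  have hN0 : 0 < N := by linarith
  rw [show N ^ ((1 : ℝ) / 2 + σ) / M * (M * N ^ (-((1 : ℝ) / 2 + σ / 2))) =
    N ^ ((1 : ℝ) / 2 + σ) * N ^ (-((1 : ℝ) / 2 + σ / 2)) from by field_simp]
  rw [← Real.rpow_add hN0]
  ring_nf

/-- `N · (M N^{−1/2−σ/2})² = M² N^{−σ}`. [folklore] -/
theorem rpow_window_sq (N σ M : ℝ) (hN : 1 ≤ N) :
    N * (M * N ^ (-((1 : ℝ) / 2 + σ / 2))) ^ 2 = M ^ 2 * N ^ (-σ) := by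
  have hN0 : 0 < N := by linarith
  rw [mul_pow, ← Real.rpow_natCast (N ^ (-((1 : ℝ) / 2 + σ / 2))) 2, ← Real.rpow_mul hN0.le]
  rw [show N * (M ^ 2 * N ^ (-(1 / 2 + σ / 2) * ((2 : ℕ) : ℝ))) =
    M ^ 2 * (N ^ (1 : ℝ) * N ^ (-(1 / 2 + σ / 2) * ((2 : ℕ) : ℝ))) from by rw [Real.rpow_one]; ring]
  rw [← Real.rpow_add hN0]
  congr 1
  push_cast
  ring_nf

/-- `√(N^{−σ}) = N^{−σ/2}`. [folklore] -/
theorem sqrt_rpow_neg (N σ : ℝ) (hN : 0 ≤ N) : Real.sqrt (N ^ (-σ)) = N ^ (-(σ / 2)) := by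
  rw [Real.sqrt_eq_rpow, ← Real.rpow_mul hN]
  ring_nf

/-- From `2δ² N^{σ/2} Q ≤ 1` to `Q ≤ N^{−σ/2}/(2δ²)`. [folklore] -/
theorem le_inv_rpow_of_window (N σ δ Q : ℝ) (hN : 1 ≤ N) (hδ : 0 < δ)
    (h : 2 * δ ^ 2 * N ^ (σ / 2) * Q ≤ 1) : Q ≤ (2 * δ ^ 2)⁻¹ * N ^ (-(σ / 2)) := by
  have hN0 : 0 < N := by linarith
  have hpow : 0 < N ^ (σ / 2) := Real.rpow_pos_of_pos hN0 _
  rw [Real.rpow_neg hN0.le, ← mul_inv, inv_eq_one_div, le_div_iff₀ (by positivity)]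
  linarith

end StubCollar

/-- **Registered: collar rarity for one residue class.** For `p ∈ (0,1]`, `δ, σ > 0`, `r ∈ ℕ`, every
non-empty finite `Λ ⊂ ℤ³` and every residue class `ρ`: the event "some `x, y ∈ Λ` carry `δ`-dense
free pieces not joined inside `Λ`, and `|Λ|^{1/2+σ} ≤ (2r+1)³ · #{a ∈ Λ : B_r(a) ⊆ Λ doubly met,
a ≡ ρ mod 2r+1}`" has probability at most
`(1/(2δ²) + √(2(2r+1)⁶p^{−u}) + (2r+1)³ + (2r+1)⁶p^{−u}) · |Λ|^{−σ/2}`, `u = ((2r+1)³+1 choose 2)`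
(template sprinkling of the balls of class `ρ` + the CCFS window).
[cite: Cerf2015, Lemma 5.1 and Prop. 5.2] -/
theorem stub_collar_class : ∀ (p : unitInterval), 0 < (p : ℝ) → ∀ (δ σ : ℝ), 0 < δ → 0 < σ → ∀ (r : ℕ) (Λ : Finset (Site 3)) (ρ : Site 3), Λ.Nonempty → (bondPercolation (zdGraph 3) p).real {ω | ∃ x ∈ Λ, ∃ y ∈ Λ, δ * (Λ.card : ℝ) ≤ (((Λ.filter fun v => ω ∈ openConnIn ↑Λ x v)).card : ℝ) ∧ δ * (Λ.card : ℝ) ≤ (((Λ.filter fun v => ω ∈ openConnIn ↑Λ y v)).card : ℝ) ∧ ω ∉ openConnIn ↑Λ x y ∧ ((Λ.card : ℝ)) ^ ((1 : ℝ) / 2 + σ) ≤ (2 * r + 1) ^ 3 * ((Λ.filter fun a => ((box 3 r).image (· + a) ⊆ Λ ∧ (∃ u ∈ Λ, (Finset.univ.sup fun j : Fin 3 => (u j - a j).natAbs) ≤ r ∧ ω ∈ openConnIn ↑Λ x u) ∧ (∃ u ∈ Λ, (Finset.univ.sup fun j : Fin 3 => (u j - a j).natAbs) ≤ r ∧ ω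 ∈ openConnIn ↑Λ y u)) ∧ (fun j => a j % (2 * (r : ℤ) + 1)) = ρ).card : ℝ)} ≤ ((2 * δ ^ 2)⁻¹ + Real.sqrt (2 * (2 * r + 1) ^ 6 * ((p : ℝ) ^ Nat.choose ((2 * r + 1) ^ 3 + 1) 2)⁻¹) + (2 * r + 1) ^ 3 + (2 * r + 1) ^ 6 * ((p : ℝ) ^ Nat.choose ((2 * r + 1) ^ 3 + 1) 2)⁻¹) * ((Λ.card : ℝ)) ^ (-(σ / 2)) := by
  intro p hp0 δ σ hδ hσ r Λ ρ hΛ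
  set E : Set (BondConfig (Site 3)) := {ω | ∃ x ∈ Λ, ∃ y ∈ Λ,
      δ * (Λ.card : ℝ) ≤ (((Λ.filter fun v => ω ∈ openConnIn ↑Λ x v)).card : ℝ) ∧
      δ * (Λ.card : ℝ) ≤ (((Λ.filter fun v => ω ∈ openConnIn ↑Λ y v)).card : ℝ) ∧
      ω ∉ openConnIn ↑Λ x y ∧
      ((Λ.card : ℝ)) ^ ((1 : ℝ) / 2 + σ) ≤ (2 * r + 1) ^ 3 * ((Λ.filter fun a =>
        ((box 3 r).image (· + a) ⊆ Λ ∧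
          (∃ u ∈ Λ, (Finset.univ.sup fun j : Fin 3 => (u j - a j).natAbs) ≤ r ∧
            ω ∈ openConnIn ↑Λ x u) ∧
          (∃ u ∈ Λ, (Finset.univ.sup fun j : Fin 3 => (u j - a j).natAbs) ≤ r ∧
            ω ∈ openConnIn ↑Λ y u)) ∧
        (fun j => a j % (2 * (r : ℤ) + 1)) = ρ).card : ℝ)} with hE
  -- the template: tiles of the class-`ρ` tiling and their blocks of lattice edges inside `Λ`
  set t : Site 3 → Site 3 := fun w j => (w j - ρ j + r) / (2 * (r : ℤ) + 1) with ht
  set I : Finset (Site 3) := Λ.image t with hI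
  set U : Site 3 → Finset (Sym2 (Site 3)) := fun k =>
    ((Λ.filter fun w => t w = k).sym2.filter fun e => e ∈ (zdGraph 3).edgeSet) with hU
  set u : ℕ := Nat.choose ((2 * r + 1) ^ 3 + 1) 2 with hu
  -- numerology
  set N : ℝ := (Λ.card : ℝ) with hN
  have hN1 : 1 ≤ N := by
    rw [hN]; exact_mod_cast Nat.succ_le_of_lt (Finset.card_pos.2 hΛ)
  have hN0 : 0 < N := by linarith
  set M : ℝ := 2 * (r : ℝ) + 1 with hM
  have hM0 : 0 < M := by rw [hM]; positivity
  set q : ℝ := (p : ℝ) ^ u with hq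
  have hq0 : 0 < q := pow_pos hp0 _
  have hp1 : (p : ℝ) ≤ 1 := p.2.2
  have hq1 : q ≤ 1 := pow_le_one₀ hp0.le hp1
  have hqi : 1 ≤ q⁻¹ := (one_le_inv₀ hq0).2 hq1
  set b : ℝ := M ^ 3 * N ^ (-((1 : ℝ) / 2 + σ / 2)) with hb
  have hb0 : 0 < b := by positivity
  set z : ℝ := M ^ 6 * q⁻¹ * N ^ (-σ) with hz
  have hz0 : 0 ≤ z := by positivity
  have hP1 : (bondPercolation (zdGraph 3) p).real E ≤ 1 := measureReal_le_one
  have hkey1 : N ^ (-((1 : ℝ) / 2 + σ / 2)) ≤ N ^ (-(σ / 2)) :=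
    Real.rpow_le_rpow_of_exponent_le hN1 (by linarith)
  have hkey2 : N ^ (-σ) ≤ N ^ (-(σ / 2)) := Real.rpow_le_rpow_of_exponent_le hN1 (by linarith)
  have hNpow : 0 < N ^ (-(σ / 2)) := Real.rpow_pos_of_pos hN0 _
  have hC1 : 0 ≤ (2 * δ ^ 2)⁻¹ := by positivity
  have hC2 : 0 ≤ Real.sqrt (2 * M ^ 6 * q⁻¹) := Real.sqrt_nonneg _
  have hC3 : 0 ≤ M ^ 3 := by positivity
  have hC4 : 0 ≤ M ^ 6 * q⁻¹ := by positivity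
  by_cases hb1 : b ≤ 1
  swap
  · -- degenerate: `b > 1`
    push Not at hb1
    calc (bondPercolation (zdGraph 3) p).real E ≤ 1 := hP1
      _ ≤ b := hb1.le
      _ ≤ M ^ 3 * N ^ (-(σ / 2)) := mul_le_mul_of_nonneg_left hkey1 hC3
      _ ≤ _ := by
          rw [show ((2 * δ ^ 2)⁻¹ + Real.sqrt (2 * M ^ 6 * q⁻¹) + M ^ 3 + M ^ 6 * q⁻¹) * N ^ (-(σ / 2)) =
            M ^ 3 * N ^ (-(σ / 2)) + ((2 * δ ^ 2)⁻¹ + Real.sqrt (2 * M ^ 6 * q⁻¹) + M ^ 6 * q⁻¹) *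
              N ^ (-(σ / 2)) from by ring]
          have := mul_nonneg (add_nonneg (add_nonneg hC1 hC2) hC4) hNpow.le
          linarith
  by_cases hz1 : z ≤ 1
  swap
  · -- degenerate: `z > 1`
    push Not at hz1
    calc (bondPercolation (zdGraph 3) p).real E ≤ 1 := hP1
      _ ≤ z := hz1.le
      _ ≤ M ^ 6 * q⁻¹ * N ^ (-(σ / 2)) := mul_le_mul_of_nonneg_left hkey2 hC4
      _ ≤ _ := by
          rw [show ((2 * δ ^ 2)⁻¹ + Real.sqrt (2 * M ^ 6 * q⁻¹) + M ^ 3 + M ^ 6 * q⁻¹) * N ^ (-(σ / 2)) =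
            M ^ 6 * q⁻¹ * N ^ (-(σ / 2)) + ((2 * δ ^ 2)⁻¹ + Real.sqrt (2 * M ^ 6 * q⁻¹) + M ^ 3) *
              N ^ (-(σ / 2)) from by ring]
          have := mul_nonneg (add_nonneg (add_nonneg hC1 hC2) hC3) hNpow.le
          linarith
  -- the event is a cylinder event over the pairs of `Λ`
  have hdet : DeterminedBy E (↑Λ.sym2 : Set (Sym2 (Site 3))) := by
    rw [determinedBy_iff]
    intro ω ω' h
    have key : ∀ a c : Site 3, ω ∈ openConnIn (↑Λ : Set (Site 3)) a c ↔
        ω' ∈ openConnIn (↑Λ : Set (Site 3)) a c := fun a c =>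
      (determinedBy_iff _ _).1 (DCT16.determinedBy_openConnIn (↑Λ : Set (Site 3)) a c
        (K := (↑Λ.sym2 : Set (Sym2 (Site 3)))) (by rw [Finset.coe_sym2])) ω ω' h
    simp only [hE, Set.mem_setOf_eq, key]
  -- the blocks: pairwise disjoint, lattice edges of `Λ`, at most `u` edges each, at most `|Λ|` many
  have hdisjU : (↑I : Set (Site 3)).PairwiseDisjoint U := by
    intro k _ k' _ hkk'
    change Disjoint (U k) (U k')
    rw [Finset.disjoint_left]
    intro e he he'
    rw [hU, Finset.mem_filter, Finset.mem_sym2_iff] at he he'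
    induction e using Sym2.ind with
    | _ v w =>
      have hv := he.1 v (Sym2.mem_mk_left v w)
      have hv' := he'.1 v (Sym2.mem_mk_left v w)
      rw [Finset.mem_filter] at hv hv'
      exact hkk' (hv.2.symm.trans hv'.2)
  have hUK : ∀ k ∈ I, U k ⊆ Λ.sym2.filter fun e => e ∈ (zdGraph 3).edgeSet := fun k _ =>
    Finset.filter_subset_filter _ (Finset.sym2_mono (Finset.filter_subset _ _))
  have htileCard : ∀ k : Site 3, (Λ.filter fun w => t w = k).card ≤ (2 * r + 1) ^ 3 := by
    intro k
    rw [← card_box 3 r]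
    refine Finset.card_le_card_of_injOn (fun w => w - fun j => ρ j + (2 * (r : ℤ) + 1) * k j) ?_ ?_
    · intro w hw
      rw [Finset.mem_coe, Finset.mem_filter] at hw
      have hw' : ∀ j, t w j = k j := fun j => congrFun hw.2 j
      rw [Finset.mem_coe, mem_box]
      intro j
      have hj := hw' j
      simp only [ht] at hj
      rw [Int.ediv_eq_iff_of_pos (by positivity), mul_comm (k j)] at hj
      simp only [Pi.sub_apply]
      omega
    · intro w _ w' _ h
      exact sub_left_injective h
  have hcardU : ∀ k ∈ I, (U k).card ≤ u := by
    intro k _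
    calc (U k).card ≤ (Λ.filter fun w => t w = k).sym2.card := Finset.card_filter_le _ _
      _ = Nat.choose ((Λ.filter fun w => t w = k).card + 1) 2 := Finset.card_sym2 _
      _ ≤ u := Nat.choose_le_choose 2 (Nat.add_le_add_right (htileCard k) 1)
  have hIcard : I.card ≤ Λ.card := Finset.card_image_le
  have hbr := stub_collar_bridge p hp0 Λ E hdet I U hdisjU hUK u hcardU hIcard
  -- the free volume functional and the indicator of the event, on finite configurations
  set F : Finset (Sym2 (Site 3)) → ℝ := fun κ =>
    (∑ v ∈ Λ, ((Λ.filter fun w => (↑κ : Set (Sym2 (Site 3))) ∈ openConnIn ↑Λ v w).card : ℝ)) /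
      (Λ.card : ℝ) ^ 2 with hF
  set χ : Finset (Sym2 (Site 3)) → ℝ := fun κ =>
    Set.indicator E (fun _ => (1 : ℝ)) (↑κ : Set (Sym2 (Site 3))) with hχ
  have hN2 : (0 : ℝ) < (Λ.card : ℝ) ^ 2 := by positivity
  have hF0 : ∀ κ, 0 ≤ F κ := fun κ =>
    div_nonneg (Finset.sum_nonneg fun v _ => Nat.cast_nonneg _) hN2.le
  have hF1 : ∀ κ, F κ ≤ 1 := fun κ =>
    (div_le_one hN2).2 (StubCollar.sum_card_piece_le Λ _)
  have hFmono : ∀ κ κ' : Finset (Sym2 (Site 3)), κ ⊆ κ' → F κ ≤ F κ' := fun κ κ' h =>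
    div_le_div_of_nonneg_right (StubCollar.sum_card_piece_mono Λ (Finset.coe_subset.2 h)) hN2.le
  have hχ0 : ∀ κ, 0 ≤ χ κ := fun κ => by
    by_cases h : (↑κ : Set (Sym2 (Site 3))) ∈ E
    · simp only [hχ, Set.indicator_of_mem h]; norm_num
    · simp only [hχ, Set.indicator_of_notMem h]; norm_num
  have hχ1 : ∀ κ, χ κ ≤ 1 := fun κ => by
    by_cases h : (↑κ : Set (Sym2 (Site 3))) ∈ E
    · simp only [hχ, Set.indicator_of_mem h]; norm_num
    · simp only [hχ, Set.indicator_of_notMem h]; norm_num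
  -- on the event, the doubly-met balls of class `ρ` are `≥ N^{1/2+σ}/(2r+1)³` good blocks
  have hgood : ∀ κ, 0 < χ κ → ∃ G ⊆ I, N ^ ((1 : ℝ) / 2 + σ) / (2 * r + 1) ^ 3 ≤ (G.card : ℝ) ∧
      ∀ k ∈ G, ¬ U k ⊆ κ ∧ F κ + 2 * δ ^ 2 ≤ F (κ ∪ U k) := by
    intro κ hκ
    have hmem : (↑κ : Set (Sym2 (Site 3))) ∈ E := by
      by_contra h
      simp only [hχ, Set.indicator_of_notMem h] at hκ
      exact lt_irrefl _ hκ
    rw [hE, Set.mem_setOf_eq] at hmem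
    obtain ⟨x, hx, y, hy, hdx, hdy, hxy, hT⟩ := hmem
    set S := Λ.filter fun a => ((box 3 r).image (· + a) ⊆ Λ ∧
      (∃ u ∈ Λ, (Finset.univ.sup fun j : Fin 3 => (u j - a j).natAbs) ≤ r ∧
        (↑κ : Set (Sym2 (Site 3))) ∈ openConnIn ↑Λ x u) ∧
      (∃ u ∈ Λ, (Finset.univ.sup fun j : Fin 3 => (u j - a j).natAbs) ≤ r ∧
        (↑κ : Set (Sym2 (Site 3))) ∈ openConnIn ↑Λ y u)) ∧
      (fun j => a j % (2 * (r : ℤ) + 1)) = ρ with hS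
    have hres : ∀ a ∈ S, ∀ j, a j % (2 * (r : ℤ) + 1) = ρ j := fun a ha j =>
      congrFun (Finset.mem_filter.1 ha).2.2 j
    have htile : ∀ a ∈ S, ∀ w ∈ (box 3 r).image (· + a), t w = t a := by
      intro a ha w hw
      have h := (StubCollar.mem_ball_iff_tile_eq r a w).1 hw
      simp only [hres a ha] at h
      exact h
    have hinj : Set.InjOn t ↑S := by
      intro a ha a' ha' h
      have hca := StubCollar.centre_eq_of_emod r a
      have hca' := StubCollar.centre_eq_of_emod r a'
      simp only [hres a ha] at hca
      simp only [hres a' ha'] at hca'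
      have e1 : (fun j => ρ j + (2 * (r : ℤ) + 1) * t a j) = a := hca
      have e2 : (fun j => ρ j + (2 * (r : ℤ) + 1) * t a' j) = a' := hca'
      rw [← e1, ← e2, h]
    obtain ⟨G, hGI, hGS, hGk⟩ := stub_collar_goodblocks Λ S r t δ κ x y hδ.le hx hy hdx hdy hxy
      (Finset.filter_subset _ _) (fun a ha => (Finset.mem_filter.1 ha).2.1) htile hinj
    refine ⟨G, hGI, ?_, hGk⟩
    rw [div_le_iff₀ (by positivity)]
    calc N ^ ((1 : ℝ) / 2 + σ) ≤ (2 * r + 1) ^ 3 * (S.card : ℝ) := hT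
      _ ≤ (2 * r + 1) ^ 3 * (G.card : ℝ) := by gcongr
      _ = (G.card : ℝ) * (2 * r + 1) ^ 3 := by ring
  obtain ⟨s, hs0, hsb, hQ⟩ := StubCollar.sprinkle_window (Λ.sym2.filter fun e => e ∈ (zdGraph 3).edgeSet)
    I U (p : ℝ) hp0.le hp1 F hF0 hF1 hFmono χ hχ0 hχ1 (2 * δ ^ 2)
    (N ^ ((1 : ℝ) / 2 + σ) / (2 * r + 1) ^ 3) (by positivity) hgood b hb0 hb1
  have hbrs := hbr s
  -- the sprinkled probability is small
  have hcoef : 2 * δ ^ 2 * (N ^ ((1 : ℝ) / 2 + σ) / (2 * r + 1) ^ 3) * b =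
      2 * δ ^ 2 * N ^ (σ / 2) := by
    rw [hb, hM, mul_assoc (2 * δ ^ 2),
      StubCollar.rpow_window_mul N σ ((2 * r + 1) ^ 3) hN1 (by positivity)]
  rw [hcoef] at hQ
  have hQ' : (∑ J ∈ I.powerset, s ^ J.card * (1 - s) ^ (I.card - J.card) *
      ∑ κ ∈ (Λ.sym2.filter fun e => e ∈ (zdGraph 3).edgeSet).powerset, (p : ℝ) ^ κ.card *
        (1 - p) ^ ((Λ.sym2.filter fun e => e ∈ (zdGraph 3).edgeSet).card - κ.card) *
        Set.indicator E (fun _ => (1 : ℝ)) (↑(κ ∪ J.biUnion U) : Set (Sym2 (Site 3)))) ≤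
      (2 * δ ^ 2)⁻¹ * N ^ (-(σ / 2)) :=
    StubCollar.le_inv_rpow_of_window N σ δ _ hN1 hδ hQ
  -- the TV cost is small
  have hs2 : s ^ 2 * q⁻¹ ≤ b ^ 2 * q⁻¹ :=
    mul_le_mul_of_nonneg_right (pow_le_pow_left₀ hs0 hsb 2) (by positivity)
  have hzN : N * (b ^ 2 * q⁻¹) = z := by
    rw [hz, hb, show N * ((M ^ 3 * N ^ (-((1 : ℝ) / 2 + σ / 2))) ^ 2 * q⁻¹) =
      N * (M ^ 3 * N ^ (-((1 : ℝ) / 2 + σ / 2))) ^ 2 * q⁻¹ from by ring,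
      StubCollar.rpow_window_sq N σ (M ^ 3) hN1]
    ring
  have htv : Real.sqrt ((1 + s ^ 2 * q⁻¹) ^ Λ.card - 1) ≤
      Real.sqrt (2 * M ^ 6 * q⁻¹) * N ^ (-(σ / 2)) := by
    have h1 : (1 + s ^ 2 * q⁻¹) ^ Λ.card ≤ (1 + b ^ 2 * q⁻¹) ^ Λ.card :=
      pow_le_pow_left₀ (by positivity) (by linarith) _
    have h2 : (1 + b ^ 2 * q⁻¹) ^ Λ.card ≤ Real.exp z := by
      rw [← hzN]
      exact StubCollar.one_add_pow_le_exp _ (by positivity) _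
    have h3 : Real.exp z - 1 ≤ 2 * z := StubCollar.exp_sub_one_le_two_mul z hz0 hz1
    calc Real.sqrt ((1 + s ^ 2 * q⁻¹) ^ Λ.card - 1) ≤ Real.sqrt (2 * z) :=
          Real.sqrt_le_sqrt (by linarith)
      _ = Real.sqrt (2 * M ^ 6 * q⁻¹) * N ^ (-(σ / 2)) := by
          rw [hz, show 2 * (M ^ 6 * q⁻¹ * N ^ (-σ)) = (2 * M ^ 6 * q⁻¹) * N ^ (-σ) from by ring,
            Real.sqrt_mul (by positivity), StubCollar.sqrt_rpow_neg N σ hN0.le]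
  -- assemble
  have hfin : (bondPercolation (zdGraph 3) p).real E ≤
      (2 * δ ^ 2)⁻¹ * N ^ (-(σ / 2)) + Real.sqrt (2 * M ^ 6 * q⁻¹) * N ^ (-(σ / 2)) := by
    linarith
  have hsum : (2 * δ ^ 2)⁻¹ * N ^ (-(σ / 2)) + Real.sqrt (2 * M ^ 6 * q⁻¹) * N ^ (-(σ / 2)) ≤
      ((2 * δ ^ 2)⁻¹ + Real.sqrt (2 * M ^ 6 * q⁻¹) + M ^ 3 + M ^ 6 * q⁻¹) * N ^ (-(σ / 2)) := by
    rw [show ((2 * δ ^ 2)⁻¹ + Real.sqrt (2 * M ^ 6 * q⁻¹) + M ^ 3 + M ^ 6 * q⁻¹) * N ^ (-(σ / 2)) =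
      (2 * δ ^ 2)⁻¹ * N ^ (-(σ / 2)) + Real.sqrt (2 * M ^ 6 * q⁻¹) * N ^ (-(σ / 2)) +
        (M ^ 3 + M ^ 6 * q⁻¹) * N ^ (-(σ / 2)) from by ring]
    have := mul_nonneg (add_nonneg hC3 hC4) hNpow.le
    linarith
  exact hfin.trans hsum

end Summit.CriticalPhenomena.PercolationContinuityZ3.Theorems.FreeBoxSparse
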